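import Literature.NumberTheory.Automorphic.LocalUnitaryGroupUnimodularOfAdelic
import Literature.NumberTheory.Automorphic.UnitaryGroupTraceClasses
import Literature.NumberTheory.Automorphic.LocalOrbitalMeasure
import HarnessLib

/-!
# Local centralisers are direct factors of adelic centralisers: local orbital measures at EVERY rational class (singular included) of an
# anisotropic unitary group
(Platonov–Rapinchuk (1994), §5.1: `G_𝔸 = G_{F_v} × G_𝔸^{(v)}` restricts to centralisers; Deitmar–Echterhoff (2014), Lemma 9.3.3, Thm. 1.5.3; Rogawski (1990),
§4.9 p. 54: the local orbital integrals `Φ(γ, f_v)` at all semisimple `γ`)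

Topic `NumberTheory/Automorphic`; namespaces `Literature.NumberTheory.Automorphic` (§1, generic locally compact groups) and `….UnitaryGroup` (§2–§3).
THEOREMS ONLY (no def, no instance, no named fact, no `sorry`).  Sequel of ★ `ModularCharacterDirectFactor` ∕ ★ `LocalUnitaryGroupUnimodularOfAdelic` (row (β) =
O6 of the F0/P3a line: orbital measures at SINGULAR semisimple local classes, [Rogawski1990, Prop. 3.8.1 (a)] — obtained WITHOUT the block centraliser,
from the adelic centraliser).  Unimodularity is phrased as in ★ `UnitaryGroupTraceClasses`: «every Haar measure on the (centraliser) subgroup is right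
invariant», measurable structures induced from the ambient group.

* §1 GENERIC **`isMulRightInvariant_centralizer_of_retraction`**: a «retraction pair» `ι : N →* G`, `π : G →* N` (`π ∘ ι = id`, both continuous) with
  `ι(N)` commuting with `ker π` restricts to CENTRALISERS — `Z_N(π g₀)` is an internal direct factor of `Z_G(g₀)` with complement `Z_G(g₀) ∩ ker π` — so
  if every Haar measure on `Z_G(g₀)` is right invariant, the same holds on `Z_N(π g₀)` (★ `modularCharacterFun_eq_one_of_isComplement`, open mapping).
* §2 `U(H)` (ANY rank, ANY rational or adelic `g₀`): **`cmDatum_toLocal_eq_localPiEquiv`** (`toLocal v g = localPiEquiv (evalPlace v (finPart g))`, the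
  datum's local component IS the place-`v` retraction of ★ `LocalUnitaryGroupUnimodularOfAdelic`) and **`isMulRightInvariant_local_centralizer_of_adelic`**
  (∕ `…_toLocal_of_adelic`): adelic centraliser unimodular ⇒ local centraliser unimodular, stated for any term `γ_v` equal to the `v`-component (pass `rfl`
  or `cmDatum_toLocal_eq_localPiEquiv`).
* §3 ANISOTROPIC `H` (every rank): the adelic centraliser of every RATIONAL `γ` is unimodular (★ `isMulRightInvariant_centralizer_cmDatum`, uniform lattice),
  hence **`isMulRightInvariant_local_centralizer_of_anisotropic`** (∕ `…_toLocal_…`) and **`exists_localOrbitalMeasure_at_of_anisotropic`** (∕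
  **`exists_localOrbitalMeasure_toLocal_of_anisotropic`**): a non-zero `U(H)(L⁺_v)`-invariant measure, finite on compact sets, on
  `U(H)(L⁺_v) ⧸ U(H)(L⁺_v)_{γ_v}`, `γ_v = toLocal v (γ ⊗ 1)`, at EVERY rational `γ` — the singular semisimple classes `{α, α, β}` of `U(3)` included (regular
  classes: ★ `LocalOrbitalMeasureRegular`; here no regularity is asked).

## References
* V. Platonov, A. Rapinchuk, *Algebraic Groups and Number Theory* (1994), §5.1 [PlatonovRapinchuk1994].
* A. Deitmar, S. Echterhoff, *Principles of Harmonic Analysis*, 2nd ed. (2014), Lemma 9.3.3, Thm. 1.5.3 [DeitmarEchterhoff2014].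
* J. Rogawski, *Automorphic Representations of Unitary Groups in Three Variables* (1990), §3.8 Prop. 3.8.1 (a) p. 27, §4.9 p. 54 [Rogawski1990].
-/

noncomputable section

open MeasureTheory Measure NumberField IsDedekindDomain Topology
open Literature.MeasureTheory.Group
open Literature.AlgebraicGeometry.ShimuraVarieties (hermForm)
open scoped Matrix MatrixGroups NNReal

/-! ## §1 Generic: a retraction pair restricts to centralisers -/

namespace Literature.NumberTheory.Automorphic

section Retraction

variable {N G : Type*} [Group N] [TopologicalSpace N] [IsTopologicalGroup N] [LocallyCompactSpace N] [SecondCountableTopology N] [T2Space N]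
  [MeasurableSpace N] [BorelSpace N]
  [Group G] [TopologicalSpace G] [IsTopologicalGroup G] [LocallyCompactSpace G] [SecondCountableTopology G] [T2Space G]
  [MeasurableSpace G] [BorelSpace G]

/-- **Centralisers inherit the direct-factor structure.**  Let `ι : N →* G`, `π : G →* N` be continuous homomorphisms with `π (ι n) = n` and `ι(N)`
commuting with `ker π`.  For every `g₀ ∈ G`: if every Haar measure on the centraliser `Z_G(g₀)` is right invariant then so is every Haar measure on
`Z_N(π g₀)` — `ι` maps `Z_N(π g₀)` into `Z_G(g₀)` (`g₀ = ι(π g₀) · c₀`, `c₀ ∈ ker π`), `Z_G(g₀) ∩ ker π` is a closed commuting complement, and ★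
`modularCharacterFun_eq_one_of_isComplement` applies. [cite: PlatonovRapinchuk1994, §5.1] [cite: DeitmarEchterhoff2014, Thm. 1.5.3] -/
theorem isMulRightInvariant_centralizer_of_retraction (ι : N →* G) (π : G →* N) (hι : Continuous ι) (hπ : Continuous π)
    (hπι : ∀ n, π (ι n) = n) (hcomm : ∀ (n : N) (g : G), π g = 1 → ι n * g = g * ι n) (g₀ : G)
    (hG : ∀ (ρ : Measure (Subgroup.centralizer ({g₀} : Set G))) [ρ.IsHaarMeasure], ρ.IsMulRightInvariant)
    (ρN : Measure (Subgroup.centralizer ({π g₀} : Set N))) [ρN.IsHaarMeasure] : ρN.IsMulRightInvariant := by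
  -- `ι` commutes with `g₀` on `Z_N(π g₀)`
  have hιZ : ∀ n : N, n * π g₀ = π g₀ * n → ι n * g₀ = g₀ * ι n := fun n hn => by
    have hc0 : π ((ι (π g₀))⁻¹ * g₀) = 1 := by rw [map_mul, map_inv, hπι, inv_mul_cancel]
    have h1 : ι n * ι (π g₀) = ι (π g₀) * ι n := by rw [← map_mul, hn, map_mul]
    have h2 := hcomm n _ hc0
    calc ι n * g₀ = ι n * (ι (π g₀) * ((ι (π g₀))⁻¹ * g₀)) := by rw [mul_inv_cancel_left]
      _ = ι (π g₀) * (ι n * ((ι (π g₀))⁻¹ * g₀)) := by rw [← mul_assoc, h1, mul_assoc]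
      _ = ι (π g₀) * (((ι (π g₀))⁻¹ * g₀) * ι n) := by rw [h2]
      _ = g₀ * ι n := by rw [← mul_assoc, mul_inv_cancel_left]
  let ι₀ : Subgroup.centralizer ({π g₀} : Set N) →* Subgroup.centralizer ({g₀} : Set G) :=
    (ι.comp (Subgroup.subtype _)).codRestrict _ fun n =>
      Subgroup.mem_centralizer_singleton_iff.mpr (hιZ n (Subgroup.mem_centralizer_singleton_iff.mp n.2))
  let π₀ : Subgroup.centralizer ({g₀} : Set G) →* N := π.comp (Subgroup.subtype _)
  haveI : LocallyCompactSpace (Subgroup.centralizer ({g₀} : Set G)) :=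
    (isClosed_coe_centralizer_singleton g₀).isClosedEmbedding_subtypeVal.locallyCompactSpace
  haveI : LocallyCompactSpace (Subgroup.centralizer ({π g₀} : Set N)) :=
    (isClosed_coe_centralizer_singleton (π g₀)).isClosedEmbedding_subtypeVal.locallyCompactSpace
  haveI : SecondCountableTopology (Subgroup.centralizer ({g₀} : Set G)) := TopologicalSpace.Subtype.secondCountableTopology _
  haveI : SecondCountableTopology (Subgroup.centralizer ({π g₀} : Set N)) := TopologicalSpace.Subtype.secondCountableTopology _
  have hι₀c : Continuous ι₀ := (hι.comp continuous_subtype_val).subtype_mk _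
  have hπ₀c : Continuous π₀ := hπ.comp continuous_subtype_val
  have hC : IsClosed ((π₀.ker : Subgroup (Subgroup.centralizer ({g₀} : Set G))) : Set (Subgroup.centralizer ({g₀} : Set G))) := by
    rw [MonoidHom.coe_ker]
    exact isClosed_singleton.preimage hπ₀c
  have hcomm₀ : ∀ (n : Subgroup.centralizer ({π g₀} : Set N)) (g : Subgroup.centralizer ({g₀} : Set G)), g ∈ π₀.ker → ι₀ n * g = g * ι₀ n :=
    fun n g hg => Subtype.ext (hcomm (n : N) (g : G) ((MonoidHom.mem_ker).mp hg))
  have hbij : Function.Bijective fun p : Subgroup.centralizer ({π g₀} : Set N) × π₀.ker => ι₀ p.1 * (p.2 : Subgroup.centralizer ({g₀} : Set G)) := by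
    constructor
    · rintro ⟨n, g⟩ ⟨n', g'⟩ hp
      have hp' : ι₀ n * (g : Subgroup.centralizer ({g₀} : Set G)) = ι₀ n' * (g' : Subgroup.centralizer ({g₀} : Set G)) := hp
      have hn : n = n' := by
        have h := congrArg π₀ hp'
        rw [map_mul, map_mul, (MonoidHom.mem_ker).mp g.2, (MonoidHom.mem_ker).mp g'.2, mul_one, mul_one] at h
        exact Subtype.ext (by simpa [ι₀, π₀, hπι] using h)
      subst hn
      exact Prod.ext rfl (Subtype.ext (mul_left_cancel hp'))
    · intro g
      have hn : π (g : G) * π g₀ = π g₀ * π (g : G) := by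
        rw [← map_mul, ← map_mul, Subgroup.mem_centralizer_singleton_iff.mp g.2]
      refine ⟨(⟨π (g : G), Subgroup.mem_centralizer_singleton_iff.mpr hn⟩, ⟨(ι₀ ⟨π (g : G), Subgroup.mem_centralizer_singleton_iff.mpr hn⟩)⁻¹ * g,
        (MonoidHom.mem_ker).mpr ?_⟩), ?_⟩
      · rw [map_mul, map_inv]
        change (π (ι (π (g : G))))⁻¹ * π (g : G) = 1
        rw [hπι, inv_mul_cancel]
      · change ι₀ _ * ((ι₀ _)⁻¹ * g) = g
        rw [mul_inv_cancel_left]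
  -- modular functions
  have hG' : ∀ z : Subgroup.centralizer ({g₀} : Set G), modularCharacterFun z = 1 := by
    haveI := hG haar
    exact fun z => modularCharacterFun_eq_one_of_isMulRightInvariant (haar : Measure (Subgroup.centralizer ({g₀} : Set G))) z
  exact isMulRightInvariant_of_modularCharacterFun_eq_one (modularCharacterFun_eq_one_of_isComplement ι₀ hι₀c π₀.ker hC hcomm₀ hbij hG') ρN

end Retraction

/-! ## §2 `U(H)`: the local centraliser is a direct factor of the adelic centraliser -/

namespace UnitaryGroup

variable (L : Type) [Field L] [NumberField L] [IsCMField L] {N : ℕ} (H : Matrix (Fin N) (Fin N) L)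
  (v : HeightOneSpectrum (𝓞 ↥(maximalRealSubfield L)))

/-- **The datum's local component IS the place-`v` retraction**: `toLocal v g = localPiEquiv (evalPlace v (finPart g))` in `U(H)(L⁺_v)` for every
`g ∈ U(H)(𝔸_{L⁺})` (entrywise both are `w ↦ (g_{ab})_w`, `w ∣ v`; ★ `localPiEquiv_evalPlace` handles the finite part, the archimedean part is not read by
`adeleToLocal`).  This is the `hγv` to pass below for `γ_v := toLocal v (γ ⊗ 1)`. [cite: PlatonovRapinchuk1994, §5.1] -/
theorem cmDatum_toLocal_eq_localPiEquiv (g : (cmDatum L N H).Adelic) :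
    (cmDatum L N H).toLocal v g = localPiEquiv L (IsCMField.complexConj L) N H v
      (evalPlace (↥(maximalRealSubfield L)) L (IsCMField.complexConj L) N H v (finPart (↥(maximalRealSubfield L)) L (IsCMField.complexConj L) N H g)) := by
  refine Subtype.ext (Units.ext (Matrix.ext fun a b => funext fun w => ?_))
  have h := localPiEquiv_evalPlace (↥(maximalRealSubfield L)) L (IsCMField.complexConj L) N H v
    (finPart (↥(maximalRealSubfield L)) L (IsCMField.complexConj L) N H g)
  change (adeleToLocal L v (((g.val : GL (Fin N) (AdeleRing (𝓞 L) L)) : Matrix (Fin N) (Fin N) (AdeleRing (𝓞 L) L)) a b) w =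
    (((localPiEquiv L (IsCMField.complexConj L) N H v (evalPlace (↥(maximalRealSubfield L)) L (IsCMField.complexConj L) N H v
        (finPart (↥(maximalRealSubfield L)) L (IsCMField.complexConj L) N H g)) : «local» L (IsCMField.complexConj L) N H v) :
      GL (Fin N) (LocalRing L v)) : Matrix (Fin N) (Fin N) (LocalRing L v)) a b w)
  rw [h]
  change (_ = adeleToLocal L v (((GLn.ofFinite N L (finPart (↥(maximalRealSubfield L)) L (IsCMField.complexConj L) N H g).1 :
      GL (Fin N) (AdeleRing (𝓞 L) L)) : Matrix (Fin N) (Fin N) (AdeleRing (𝓞 L) L)) a b) w)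
  rw [adeleToLocal_apply, adeleToLocal_apply, GLn.coe_ofFinite_apply]
  rfl

variable [MeasurableSpace (cmDatum L N H).Adelic] [BorelSpace (cmDatum L N H).Adelic]
  [MeasurableSpace ((cmDatum L N H).Local v)] [BorelSpace ((cmDatum L N H).Local v)]

/-- **Local centraliser unimodularity from adelic centraliser unimodularity**, every rank, every `g₀ ∈ U(H)(𝔸_{L⁺})`: with the `v`-component
`g₀,ᵥ := localPiEquiv (evalPlace v (finPart g₀)) ∈ U(H)(L⁺_v)`, if every Haar measure on the adelic centraliser `U(H)(𝔸)_{g₀}` is right invariant then so is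
every Haar measure on the local centraliser `U(H)(L⁺_v)_{g₀,ᵥ}` (§1 with the retraction pair of ★ `LocalUnitaryGroupUnimodularOfAdelic`).
[cite: PlatonovRapinchuk1994, §5.1] [cite: Rogawski1990, §4.9 p. 54] -/
theorem isMulRightInvariant_local_centralizer_of_adelic (g₀ : (cmDatum L N H).Adelic) (γv : (cmDatum L N H).Local v)
    (hγv : γv = localPiEquiv L (IsCMField.complexConj L) N H v
      (evalPlace (↥(maximalRealSubfield L)) L (IsCMField.complexConj L) N H v (finPart (↥(maximalRealSubfield L)) L (IsCMField.complexConj L) N H g₀)))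
    (hZ : ∀ (ρ : Measure (Subgroup.centralizer ({g₀} : Set (cmDatum L N H).Adelic))) [ρ.IsHaarMeasure], ρ.IsMulRightInvariant)
    (ρv : Measure (Subgroup.centralizer ({γv} : Set ((cmDatum L N H).Local v)))) [ρv.IsHaarMeasure] : ρv.IsMulRightInvariant := by
  subst hγv
  haveI : LocallyCompactSpace (adelicGroupData (↥(maximalRealSubfield L)) L (IsCMField.complexConj L) N H).Adelic :=
    locallyCompactSpace_cmDatum_Adelic L N H
  haveI : SecondCountableTopology (adelicGroupData (↥(maximalRealSubfield L)) L (IsCMField.complexConj L) N H).Adelic :=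
    secondCountableTopology_cmDatum_Adelic L N H
  haveI : T2Space (adelicGroupData (↥(maximalRealSubfield L)) L (IsCMField.complexConj L) N H).Adelic := t2Space_cmDatum_Adelic L N H
  letI : MeasurableSpace (adelicGroupData (↥(maximalRealSubfield L)) L (IsCMField.complexConj L) N H).Adelic := ‹MeasurableSpace (cmDatum L N H).Adelic›
  haveI : BorelSpace (adelicGroupData (↥(maximalRealSubfield L)) L (IsCMField.complexConj L) N H).Adelic := ‹BorelSpace (cmDatum L N H).Adelic›
  letI : MeasurableSpace (↥(«local» L (IsCMField.complexConj L) N H v)) := ‹MeasurableSpace ((cmDatum L N H).Local v)›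
  haveI : BorelSpace (↥(«local» L (IsCMField.complexConj L) N H v)) := ‹BorelSpace ((cmDatum L N H).Local v)›
  -- `ι = inclPlaceAdelic ∘ localPiEquiv⁻¹`, `π = localPiEquiv ∘ evalPlace v ∘ finPart`
  have hπι : ∀ y : «local» L (IsCMField.complexConj L) N H v,
      ((localPiEquiv L (IsCMField.complexConj L) N H v).toMonoidHom.comp ((evalPlace (↥(maximalRealSubfield L)) L (IsCMField.complexConj L) N H v).comp
        (finPart (↥(maximalRealSubfield L)) L (IsCMField.complexConj L) N H)))
        (((inclPlaceAdelic (↥(maximalRealSubfield L)) L (IsCMField.complexConj L) N H v).comp (localPiEquiv L (IsCMField.complexConj L) N H v).symm.toMonoidHom) y) =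
          y := fun y => by
    change localPiEquiv L (IsCMField.complexConj L) N H v (evalPlace (↥(maximalRealSubfield L)) L (IsCMField.complexConj L) N H v
      (finPart (↥(maximalRealSubfield L)) L (IsCMField.complexConj L) N H
        (inclPlaceAdelic (↥(maximalRealSubfield L)) L (IsCMField.complexConj L) N H v ((localPiEquiv L (IsCMField.complexConj L) N H v).symm y)))) = y
    rw [finPart_inclPlaceAdelic, evalPlace_inclPlace, ContinuousMulEquiv.apply_symm_apply]
  have hιc : Continuous ((inclPlaceAdelic (↥(maximalRealSubfield L)) L (IsCMField.complexConj L) N H v).comp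
      (localPiEquiv L (IsCMField.complexConj L) N H v).symm.toMonoidHom) :=
    (continuous_inclPlaceAdelic (↥(maximalRealSubfield L)) L (IsCMField.complexConj L) N H v).comp (localPiEquiv L (IsCMField.complexConj L) N H v).symm.continuous
  have hπc : Continuous ((localPiEquiv L (IsCMField.complexConj L) N H v).toMonoidHom.comp ((evalPlace (↥(maximalRealSubfield L)) L (IsCMField.complexConj L) N H v).comp
      (finPart (↥(maximalRealSubfield L)) L (IsCMField.complexConj L) N H))) :=
    (localPiEquiv L (IsCMField.complexConj L) N H v).continuous.comp ((continuous_evalPlace (↥(maximalRealSubfield L)) L (IsCMField.complexConj L) N H v).comp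
      (continuous_finPart (↥(maximalRealSubfield L)) L (IsCMField.complexConj L) N H))
  have hcomm : ∀ (n : «local» L (IsCMField.complexConj L) N H v) (g : (adelicGroupData (↥(maximalRealSubfield L)) L (IsCMField.complexConj L) N H).Adelic),
      ((localPiEquiv L (IsCMField.complexConj L) N H v).toMonoidHom.comp ((evalPlace (↥(maximalRealSubfield L)) L (IsCMField.complexConj L) N H v).comp
        (finPart (↥(maximalRealSubfield L)) L (IsCMField.complexConj L) N H))) g = 1 →
      ((inclPlaceAdelic (↥(maximalRealSubfield L)) L (IsCMField.complexConj L) N H v).comp (localPiEquiv L (IsCMField.complexConj L) N H v).symm.toMonoidHom) n * g =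
        g * ((inclPlaceAdelic (↥(maximalRealSubfield L)) L (IsCMField.complexConj L) N H v).comp (localPiEquiv L (IsCMField.complexConj L) N H v).symm.toMonoidHom) n := by
    intro n g hg
    have hg1 : evalPlace (↥(maximalRealSubfield L)) L (IsCMField.complexConj L) N H v (finPart (↥(maximalRealSubfield L)) L (IsCMField.complexConj L) N H g) = 1 := by
      have h : localPiEquiv L (IsCMField.complexConj L) N H v (evalPlace (↥(maximalRealSubfield L)) L (IsCMField.complexConj L) N H v
          (finPart (↥(maximalRealSubfield L)) L (IsCMField.complexConj L) N H g)) = 1 := hg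
      rw [← map_one (localPiEquiv L (IsCMField.complexConj L) N H v)] at h
      exact (localPiEquiv L (IsCMField.complexConj L) N H v).injective h
    change inclPlaceAdelic (↥(maximalRealSubfield L)) L (IsCMField.complexConj L) N H v ((localPiEquiv L (IsCMField.complexConj L) N H v).symm n) * g =
      g * inclPlaceAdelic (↥(maximalRealSubfield L)) L (IsCMField.complexConj L) N H v ((localPiEquiv L (IsCMField.complexConj L) N H v).symm n)
    rw [← archToAdelic_mul_finAdelicToAdelic (↥(maximalRealSubfield L)) L (IsCMField.complexConj L) N H g]
    have h1 : Commute (inclPlaceAdelic (↥(maximalRealSubfield L)) L (IsCMField.complexConj L) N H v ((localPiEquiv L (IsCMField.complexConj L) N H v).symm n))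
        (archToAdelic (↥(maximalRealSubfield L)) L (IsCMField.complexConj L) N H (archPart (↥(maximalRealSubfield L)) L (IsCMField.complexConj L) N H g)) :=
      (commute_archToAdelic_inclPlaceAdelic (↥(maximalRealSubfield L)) L (IsCMField.complexConj L) N H
        (archPart (↥(maximalRealSubfield L)) L (IsCMField.complexConj L) N H g) v ((localPiEquiv L (IsCMField.complexConj L) N H v).symm n)).symm
    have h2 : Commute (inclPlaceAdelic (↥(maximalRealSubfield L)) L (IsCMField.complexConj L) N H v ((localPiEquiv L (IsCMField.complexConj L) N H v).symm n))
        (finAdelicToAdelic (↥(maximalRealSubfield L)) L (IsCMField.complexConj L) N H (finPart (↥(maximalRealSubfield L)) L (IsCMField.complexConj L) N H g)) := by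
      rw [inclPlaceAdelic_apply]
      have h := commute_inclPlace_of_evalPlace_eq_one (↥(maximalRealSubfield L)) L (IsCMField.complexConj L) N H (v := v)
        (g := finPart (↥(maximalRealSubfield L)) L (IsCMField.complexConj L) N H g) hg1 ((localPiEquiv L (IsCMField.complexConj L) N H v).symm n)
      change finAdelicToAdelic (↥(maximalRealSubfield L)) L (IsCMField.complexConj L) N H
            (inclPlace (↥(maximalRealSubfield L)) L (IsCMField.complexConj L) N H v ((localPiEquiv L (IsCMField.complexConj L) N H v).symm n)) *
          finAdelicToAdelic (↥(maximalRealSubfield L)) L (IsCMField.complexConj L) N H (finPart (↥(maximalRealSubfield L)) L (IsCMField.complexConj L) N H g) =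
        finAdelicToAdelic (↥(maximalRealSubfield L)) L (IsCMField.complexConj L) N H (finPart (↥(maximalRealSubfield L)) L (IsCMField.complexConj L) N H g) *
          finAdelicToAdelic (↥(maximalRealSubfield L)) L (IsCMField.complexConj L) N H
            (inclPlace (↥(maximalRealSubfield L)) L (IsCMField.complexConj L) N H v ((localPiEquiv L (IsCMField.complexConj L) N H v).symm n))
      rw [← map_mul, ← map_mul, h.eq]
    exact (h1.mul_right h2).eq
  have key := isMulRightInvariant_centralizer_of_retraction _ _ hιc hπc hπι hcomm g₀ hZ
  exact @key ρv ‹_›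

/-- The same with the datum's own local component `γ_v := toLocal v g₀`. [cite: PlatonovRapinchuk1994, §5.1] -/
theorem isMulRightInvariant_local_centralizer_toLocal_of_adelic (g₀ : (cmDatum L N H).Adelic)
    (hZ : ∀ (ρ : Measure (Subgroup.centralizer ({g₀} : Set (cmDatum L N H).Adelic))) [ρ.IsHaarMeasure], ρ.IsMulRightInvariant)
    (ρv : Measure (Subgroup.centralizer ({(cmDatum L N H).toLocal v g₀} : Set ((cmDatum L N H).Local v)))) [ρv.IsHaarMeasure] :
    ρv.IsMulRightInvariant :=
  isMulRightInvariant_local_centralizer_of_adelic L H v g₀ _ (cmDatum_toLocal_eq_localPiEquiv L H v g₀) hZ ρv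

/-! ## §3 Anisotropic `H`: local orbital measures at EVERY rational class -/

/-- **For ANISOTROPIC `H` (every rank), every Haar measure on the local centraliser `U(H)(L⁺_v)_{γ_v}` of a RATIONAL `γ` is right invariant**, at
every finite `v` (the adelic centraliser is unimodular, ★ `isMulRightInvariant_centralizer_cmDatum`, and §2) — regular, central and SINGULAR
semisimple `γ` alike. [cite: Rogawski1990, §4.9 p. 54] [cite: DeitmarEchterhoff2014, Lemma 9.3.3] -/
theorem isMulRightInvariant_local_centralizer_of_anisotropic (hanis : ∀ x : Fin N → L, hermForm (cmConjRingHom L) H x x = 0 → x = 0)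
    (γ : (cmDatum L N H).Rational) (γv : (cmDatum L N H).Local v)
    (hγv : γv = localPiEquiv L (IsCMField.complexConj L) N H v
      (evalPlace (↥(maximalRealSubfield L)) L (IsCMField.complexConj L) N H v
        (finPart (↥(maximalRealSubfield L)) L (IsCMField.complexConj L) N H ((cmDatum L N H).toAdelic γ))))
    (ρv : Measure (Subgroup.centralizer ({γv} : Set ((cmDatum L N H).Local v)))) [ρv.IsHaarMeasure] : ρv.IsMulRightInvariant :=
  isMulRightInvariant_local_centralizer_of_adelic L H v ((cmDatum L N H).toAdelic γ) γv hγv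
    (fun ρ _ => isMulRightInvariant_centralizer_cmDatum L N H hanis (γ := (cmDatum L N H).toAdelic γ) ⟨γ, rfl⟩ ρ) ρv

/-- **Local orbital measures at EVERY rational class of an anisotropic unitary group** (every rank, every finite `v`; the singular semisimple classes
`{α, α, β}` of `U(3)` included): for any Haar `ν` on `U(H)(L⁺_v)` there is a non-zero `U(H)(L⁺_v)`-invariant measure, finite on compact sets, on
`U(H)(L⁺_v) ⧸ U(H)(L⁺_v)_{γ_v}` — the measure of the local orbital integrals `Φ(γ, f_v) = ∫ f_v(x⁻¹ γ_v x) dẋ` (★ `exists_smulInvariantMeasure_quotient_centralizer`,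
with its quotient integral formula; the group is unimodular by ★ `isMulRightInvariant_cmDatum_local_of_adelic`, the centraliser by the theorem above, so the Haar
measure of the centraliser is inversion invariant).  `γ_v` is any term equal to the `v`-component `localPiEquiv (evalPlace v (finPart (γ ⊗ 1)))` (pass `rfl`).
[cite: Rogawski1990, §4.9 p. 54] [cite: DeitmarEchterhoff2014, Thm. 1.5.3] -/
theorem exists_localOrbitalMeasure_at_of_anisotropic (hanis : ∀ x : Fin N → L, hermForm (cmConjRingHom L) H x x = 0 → x = 0)
    (γ : (cmDatum L N H).Rational) (γv : (cmDatum L N H).Local v)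
    (hγv : γv = localPiEquiv L (IsCMField.complexConj L) N H v
      (evalPlace (↥(maximalRealSubfield L)) L (IsCMField.complexConj L) N H v
        (finPart (↥(maximalRealSubfield L)) L (IsCMField.complexConj L) N H ((cmDatum L N H).toAdelic γ))))
    (ν : Measure ((cmDatum L N H).Local v)) [ν.IsHaarMeasure]
    [MeasurableSpace ((cmDatum L N H).Local v ⧸ Subgroup.centralizer ({γv} : Set ((cmDatum L N H).Local v)))]
    [BorelSpace ((cmDatum L N H).Local v ⧸ Subgroup.centralizer ({γv} : Set ((cmDatum L N H).Local v)))] :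
    ∃ m : Measure ((cmDatum L N H).Local v ⧸ Subgroup.centralizer ({γv} : Set ((cmDatum L N H).Local v))),
      SMulInvariantMeasure ((cmDatum L N H).Local v) _ m ∧ IsFiniteMeasureOnCompacts m ∧ m ≠ 0 := by
  haveI : ν.IsMulRightInvariant :=
    isMulRightInvariant_cmDatum_local_of_adelic L H v (modularCharacter_cmDatum_eq_one_of_anisotropic L H hanis) ν
  haveI : LocallyCompactSpace (Subgroup.centralizer ({γv} : Set ((cmDatum L N H).Local v))) :=
    (isClosed_coe_centralizer_singleton γv).isClosedEmbedding_subtypeVal.locallyCompactSpace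
  haveI : SecondCountableTopology (Subgroup.centralizer ({γv} : Set ((cmDatum L N H).Local v))) := TopologicalSpace.Subtype.secondCountableTopology _
  haveI : (haar : Measure (Subgroup.centralizer ({γv} : Set ((cmDatum L N H).Local v)))).IsMulRightInvariant :=
    isMulRightInvariant_local_centralizer_of_anisotropic L H v hanis γ γv hγv haar
  haveI : (haar : Measure (Subgroup.centralizer ({γv} : Set ((cmDatum L N H).Local v)))).IsInvInvariant := isInvInvariant_of_isMulRightInvariant _
  obtain ⟨m, hinv, hreg, hne, -⟩ := exists_smulInvariantMeasure_quotient_centralizer (G := (cmDatum L N H).Local v) γv ν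
    (haar : Measure (Subgroup.centralizer ({γv} : Set ((cmDatum L N H).Local v))))
  haveI := hreg
  exact ⟨m, hinv, inferInstance, hne⟩

/-- ★ `isMulRightInvariant_local_centralizer_of_anisotropic` at the datum's own local component `γ_v := toLocal v (γ ⊗ 1)`.
[cite: Rogawski1990, §4.9 p. 54] -/
theorem isMulRightInvariant_local_centralizer_toLocal_of_anisotropic (hanis : ∀ x : Fin N → L, hermForm (cmConjRingHom L) H x x = 0 → x = 0)
    (γ : (cmDatum L N H).Rational)
    (ρv : Measure (Subgroup.centralizer ({(cmDatum L N H).toLocal v ((cmDatum L N H).toAdelic γ)} : Set ((cmDatum L N H).Local v))))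
    [ρv.IsHaarMeasure] : ρv.IsMulRightInvariant :=
  isMulRightInvariant_local_centralizer_of_anisotropic L H v hanis γ _ (cmDatum_toLocal_eq_localPiEquiv L H v _) ρv

/-- ★ `exists_localOrbitalMeasure_at_of_anisotropic` at the datum's own local component `γ_v := toLocal v (γ ⊗ 1)`: **the local orbital measure on
`U(H)(L⁺_v) ⧸ U(H)(L⁺_v)_{γ_v}` exists at EVERY rational `γ` of an anisotropic `U(H)`, every rank, every finite `v`.** [cite: Rogawski1990, §4.9 p. 54]
[cite: DeitmarEchterhoff2014, Thm. 1.5.3] -/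
theorem exists_localOrbitalMeasure_toLocal_of_anisotropic (hanis : ∀ x : Fin N → L, hermForm (cmConjRingHom L) H x x = 0 → x = 0)
    (γ : (cmDatum L N H).Rational) (ν : Measure ((cmDatum L N H).Local v)) [ν.IsHaarMeasure]
    [MeasurableSpace ((cmDatum L N H).Local v ⧸
      Subgroup.centralizer ({(cmDatum L N H).toLocal v ((cmDatum L N H).toAdelic γ)} : Set ((cmDatum L N H).Local v)))]
    [BorelSpace ((cmDatum L N H).Local v ⧸
      Subgroup.centralizer ({(cmDatum L N H).toLocal v ((cmDatum L N H).toAdelic γ)} : Set ((cmDatum L N H).Local v)))] :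
    ∃ m : Measure ((cmDatum L N H).Local v ⧸
        Subgroup.centralizer ({(cmDatum L N H).toLocal v ((cmDatum L N H).toAdelic γ)} : Set ((cmDatum L N H).Local v))),
      SMulInvariantMeasure ((cmDatum L N H).Local v) _ m ∧ IsFiniteMeasureOnCompacts m ∧ m ≠ 0 :=
  exists_localOrbitalMeasure_at_of_anisotropic L H v hanis γ _ (cmDatum_toLocal_eq_localPiEquiv L H v _) ν

end UnitaryGroup

end Literature.NumberTheory.Automorphic
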